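import Mathlib
import Literature.Analysis.Convexity.AnisotropicPerimeterPolytopeUnion
import Literature.Analysis.Convexity.AnisotropicPerimeterComplement
import HarnessLib

/-!
# Super-level sets of piecewise-affine functions on polytopal complexes of `ℝ³`, I: the pieces

Topic `Literature/Analysis/Convexity`; namespace `Literature.Analysis.Convexity`.

Setting (shared by parts I–IV, files `AnisotropicPerimeterLevelPieces/LevelFacet/LevelSets/PLCoarea`):
finitely many pairwise disjoint bounded open `H`-polytopes ("cells")
`Q_i = ⋂_{p ∈ H_i} {⟪p.1, ·⟫ < p.2}` of `EuclideanSpace ℝ (Fin 3)`, and a continuous `f : ℝ³ → ℝ`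
which is affine on the closure of every cell, `f = ⟪g_i, ·⟫ + b_i` on `closure Q_i`.  This file:

* `inter_superlevel_eq_openHPolytope_insert` — the piece `Q ∩ {f > t}` is the open `H`-polytope of
  `insert (-g, b - t) H`; the unit normal form of the enlarged constraint set
  (`normalForm_insert_of_ne_zero`, `normalForm_insert_of_eq_zero`) and the normalised level
  constraint `(‖-g‖⁻¹ • (-g), ‖-g‖⁻¹ (b - t))` (`plane_levelConstraint_eq`; in general position —
  the level plane is not a facet plane — it is a new, non-proportional constraint:
  `levelConstraint_not_mem_normalForm`, `not_proportional_levelConstraint`);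
* `exists_mem_closure_piece_of_facet` — **the covering lemma**: if `{f > t} ⊆ ⋃ closure Q_j`, a point
  of a facet plane of `Q_i` in `closure Q_i` with `f > t` lies in `closure (Q_j ∩ {f > t})` for some
  `j ≠ i` (push it slightly outwards; the other cells' closures form a closed set);
* `superlevel_ae_eq_iUnion_pieces` — `{f > t} =ᵐ ⋃ (Q_i ∩ {f > t})` (null frontiers).

[cite: Maggi2012, (20.2) p. 258 and Remark 20.3 (anisotropic perimeter of polyhedral sets as facet
sums); EvansGariepy2015, §5 Thm 5.16 (Gauss–Green) and §3.4.4 Thm 3.13 (level sets) — here the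
elementary polyhedral / piecewise-affine case]
-/

noncomputable section

namespace Literature.Analysis.Convexity

open _root_.MeasureTheory Set Filter
open scoped RealInnerProductSpace Topology ENNReal
open Literature.MeasureTheory.Integral

/-! ### Pieces of a cell cut by a level are open `H`-polytopes -/

/-- **A cell cut by a super-level set of a function affine on it is again an open `H`-polytope**:
if `f = ⟪g, ·⟫ + b` on `closure Q`, `Q = ⋂_{p ∈ H} {⟪p.1, ·⟫ < p.2}`, then
`Q ∩ {f > t} = ⋂_{p ∈ insert (-g, b - t) H} {⟪p.1, ·⟫ < p.2}` (for `g = 0` the new constraint is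
`univ` or `∅`). [cite: Maggi2012, Remark 20.3 p. 258 — plumbing] -/
theorem inter_superlevel_eq_openHPolytope_insert (H : Finset (EuclideanSpace ℝ (Fin 3) × ℝ))
    {Q : Set (EuclideanSpace ℝ (Fin 3))}
    (hQ : Q = ⋂ p ∈ H, {x : EuclideanSpace ℝ (Fin 3) | ⟪p.1, x⟫ < p.2})
    (g : EuclideanSpace ℝ (Fin 3)) (b t : ℝ) {f : EuclideanSpace ℝ (Fin 3) → ℝ}
    (hf : ∀ x ∈ closure Q, f x = ⟪g, x⟫ + b) :
    Q ∩ {x | t < f x} =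
      ⋂ p ∈ insert (-g, b - t) H, {x : EuclideanSpace ℝ (Fin 3) | ⟪p.1, x⟫ < p.2} := by
  classical
  rw [Finset.set_biInter_insert, ← hQ]
  ext x
  simp only [mem_inter_iff, mem_setOf_eq, inner_neg_left]
  constructor
  · rintro ⟨hxQ, hxt⟩
    have hfx := hf x (subset_closure hxQ)
    exact ⟨by linarith, hxQ⟩
  · rintro ⟨hxt, hxQ⟩
    have hfx := hf x (subset_closure hxQ)
    exact ⟨hxQ, by linarith⟩

/-- The unit normal form of `insert q H` for a constraint with `q.1 ≠ 0` is `insert` of the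
normalised constraint. [cite: Rockafellar1970, §6 Thm 6.3 — plumbing] -/
theorem normalForm_insert_of_ne_zero (H : Finset (EuclideanSpace ℝ (Fin 3) × ℝ))
    (q : EuclideanSpace ℝ (Fin 3) × ℝ) (hq : q.1 ≠ 0) :
    ((insert q H).filter (fun p => p.1 ≠ 0)).image (fun p => (‖p.1‖⁻¹ • p.1, ‖p.1‖⁻¹ * p.2)) =
      insert (‖q.1‖⁻¹ • q.1, ‖q.1‖⁻¹ * q.2)
        ((H.filter (fun p => p.1 ≠ 0)).image (fun p => (‖p.1‖⁻¹ • p.1, ‖p.1‖⁻¹ * p.2))) := by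
  classical
  rw [Finset.filter_insert, if_pos hq, Finset.image_insert]

/-- The unit normal form ignores a constraint with zero normal.
[cite: Rockafellar1970, §6 Thm 6.3 — plumbing] -/
theorem normalForm_insert_of_eq_zero (H : Finset (EuclideanSpace ℝ (Fin 3) × ℝ))
    (q : EuclideanSpace ℝ (Fin 3) × ℝ) (hq : q.1 = 0) :
    ((insert q H).filter (fun p => p.1 ≠ 0)).image (fun p => (‖p.1‖⁻¹ • p.1, ‖p.1‖⁻¹ * p.2)) =
      (H.filter (fun p => p.1 ≠ 0)).image (fun p => (‖p.1‖⁻¹ • p.1, ‖p.1‖⁻¹ * p.2)) := by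
  classical
  rw [Finset.filter_insert, if_neg (by simpa using hq)]

/-- Normalising a constraint does not change its plane. [cite: Rockafellar1970, §6 Thm 6.3 — plumbing] -/
theorem plane_normalize_eq (p : EuclideanSpace ℝ (Fin 3) × ℝ) (hp : p.1 ≠ 0) :
    {x : EuclideanSpace ℝ (Fin 3) | ⟪‖p.1‖⁻¹ • p.1, x⟫ = ‖p.1‖⁻¹ * p.2} = {x | ⟪p.1, x⟫ = p.2} := by
  have h0 : ‖p.1‖⁻¹ ≠ 0 := inv_ne_zero (norm_ne_zero_iff.2 hp)
  ext x
  simp only [mem_setOf_eq, real_inner_smul_left]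
  exact ⟨fun h => mul_left_cancel₀ h0 h, fun h => by rw [h]⟩

/-- Proportional constraints (with a unit normal on the second one) have the same plane.
[cite: Rockafellar1970, §6 Thm 6.3 — plumbing] -/
theorem plane_eq_of_proportional {c c' : EuclideanSpace ℝ (Fin 3) × ℝ} (h1' : ‖c'.1‖ = 1)
    (h : ∃ μ : ℝ, c'.1 = μ • c.1 ∧ c'.2 = μ * c.2) :
    {x : EuclideanSpace ℝ (Fin 3) | ⟪c'.1, x⟫ = c'.2} = {x | ⟪c.1, x⟫ = c.2} := by
  obtain ⟨μ, hμ1, hμ2⟩ := h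
  have hμ : μ ≠ 0 := by
    rintro rfl
    rw [zero_smul] at hμ1
    rw [hμ1, norm_zero] at h1'
    exact zero_ne_one h1'
  ext x
  simp only [mem_setOf_eq, hμ1, hμ2, real_inner_smul_left]
  exact ⟨fun h => mul_left_cancel₀ hμ h, fun h => by rw [h]⟩

/-- The plane of the normalised level constraint `(‖-g‖⁻¹ • (-g), ‖-g‖⁻¹ * (b - t))` is the level
plane `{⟪g, ·⟫ + b = t}`. [cite: Maggi2012, Remark 20.3 p. 258 — plumbing] -/
theorem plane_levelConstraint_eq (g : EuclideanSpace ℝ (Fin 3)) (hg : g ≠ 0) (b t : ℝ) :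
    {x : EuclideanSpace ℝ (Fin 3) | ⟪‖-g‖⁻¹ • (-g), x⟫ = ‖-g‖⁻¹ * (b - t)} =
      {x | ⟪g, x⟫ + b = t} := by
  have h := plane_normalize_eq ((-g, b - t) : EuclideanSpace ℝ (Fin 3) × ℝ) (by simpa using hg)
  simp only at h
  rw [h]
  ext x
  simp only [mem_setOf_eq, inner_neg_left]
  constructor <;> intro hx <;> linarith

/-- In general position the normalised level constraint is not a constraint of the cell's normal
form. [cite: Maggi2012, Remark 20.3 p. 258 — plumbing] -/
theorem levelConstraint_not_mem_normalForm (H : Finset (EuclideanSpace ℝ (Fin 3) × ℝ))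
    (g : EuclideanSpace ℝ (Fin 3)) (hg : g ≠ 0) (b t : ℝ)
    (hgen : ∀ p ∈ H, {x : EuclideanSpace ℝ (Fin 3) | ⟪g, x⟫ + b = t} ≠ {x | ⟪p.1, x⟫ = p.2}) :
    ((‖-g‖⁻¹ • (-g), ‖-g‖⁻¹ * (b - t)) : EuclideanSpace ℝ (Fin 3) × ℝ) ∉
      (H.filter (fun p => p.1 ≠ 0)).image (fun p => (‖p.1‖⁻¹ • p.1, ‖p.1‖⁻¹ * p.2)) := by
  intro hmem
  obtain ⟨p, hp, hpeq⟩ := Finset.mem_image.1 hmem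
  obtain ⟨hpH, hp0⟩ := Finset.mem_filter.1 hp
  apply hgen p hpH
  rw [← plane_levelConstraint_eq g hg b t, ← plane_normalize_eq p hp0]
  have h1 : ‖p.1‖⁻¹ • p.1 = ‖-g‖⁻¹ • (-g) := congrArg Prod.fst hpeq
  have h2 : ‖p.1‖⁻¹ * p.2 = ‖-g‖⁻¹ * (b - t) := congrArg Prod.snd hpeq
  rw [h1, h2]

/-- In general position no constraint of the cell's normal form is proportional to the normalised
level constraint. [cite: Maggi2012, Remark 20.3 p. 258 — plumbing] -/
theorem not_proportional_levelConstraint (H : Finset (EuclideanSpace ℝ (Fin 3) × ℝ))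
    (g : EuclideanSpace ℝ (Fin 3)) (hg : g ≠ 0) (b t : ℝ)
    (hgen : ∀ p ∈ H, {x : EuclideanSpace ℝ (Fin 3) | ⟪g, x⟫ + b = t} ≠ {x | ⟪p.1, x⟫ = p.2})
    {c : EuclideanSpace ℝ (Fin 3) × ℝ}
    (hc : c ∈ (H.filter (fun p => p.1 ≠ 0)).image (fun p => (‖p.1‖⁻¹ • p.1, ‖p.1‖⁻¹ * p.2))) :
    ¬ ∃ μ : ℝ, c.1 = μ • (‖-g‖⁻¹ • (-g)) ∧ c.2 = μ * (‖-g‖⁻¹ * (b - t)) := by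
  intro h
  have h1 : ‖c.1‖ = 1 := norm_eq_one_of_mem_normalForm H hc
  have key : {x : EuclideanSpace ℝ (Fin 3) | ⟪c.1, x⟫ = c.2} =
      {x | ⟪‖-g‖⁻¹ • (-g), x⟫ = ‖-g‖⁻¹ * (b - t)} :=
    plane_eq_of_proportional (c := ((‖-g‖⁻¹ • (-g), ‖-g‖⁻¹ * (b - t)) :
      EuclideanSpace ℝ (Fin 3) × ℝ)) (c' := c) h1 h
  obtain ⟨p, hp, rfl⟩ := Finset.mem_image.1 hc
  obtain ⟨hpH, hp0⟩ := Finset.mem_filter.1 hp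
  apply hgen p hpH
  rw [← plane_levelConstraint_eq g hg b t, ← key]
  exact plane_normalize_eq p hp0

/-! ### Cell facets above the level are covered by the neighbouring pieces -/

/-- **A cell facet point above the level lies in the closure of another piece.**  Let the cells
`Q_j` be open `H`-polytopes, `f` continuous with `{f > t} ⊆ ⋃ closure Q_j`.  If `x ∈ closure Q_i`
lies on the plane of a constraint `c` of the unit normal form of `H_i` and `f x > t`, then
`x ∈ closure (Q_j ∩ {f > t})` for some `j ≠ i` (push `x` slightly outwards along `c.1`: the points
stay in `{f > t}`, hence in some `closure Q_j`, `j ≠ i`, and these closed sets contain the limit `x`).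
[cite: EvansGariepy2015, Thm 5.16 (Gauss–Green), polyhedral case — plumbing] -/
theorem exists_mem_closure_piece_of_facet {k : ℕ} (H : Fin k → Finset (EuclideanSpace ℝ (Fin 3) × ℝ))
    (Q : Fin k → Set (EuclideanSpace ℝ (Fin 3)))
    (hQ : ∀ i, Q i = ⋂ p ∈ H i, {x : EuclideanSpace ℝ (Fin 3) | ⟪p.1, x⟫ < p.2})
    {f : EuclideanSpace ℝ (Fin 3) → ℝ} (hfc : Continuous f) {t : ℝ}
    (hcov : {x | t < f x} ⊆ ⋃ i, closure (Q i)) {i : Fin k} {c : EuclideanSpace ℝ (Fin 3) × ℝ}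
    (hc : c ∈ ((H i).filter (fun p => p.1 ≠ 0)).image (fun p => (‖p.1‖⁻¹ • p.1, ‖p.1‖⁻¹ * p.2)))
    {x : EuclideanSpace ℝ (Fin 3)} (hx1 : ⟪c.1, x⟫ = c.2) (hxt : t < f x) :
    ∃ j, j ≠ i ∧ x ∈ closure (Q j ∩ {x | t < f x}) := by
  classical
  have h1 : ‖c.1‖ = 1 := norm_eq_one_of_mem_normalForm (H i) hc
  -- `closure Q_i` lies in the closed half-space of `c`
  have hQi_sub : Q i ⊆ {y : EuclideanSpace ℝ (Fin 3) | ⟪c.1, y⟫ < c.2} := by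
    rw [hQ i]
    exact (openHPolytope_subset_normalForm (H i)).trans (Set.biInter_subset_of_mem hc)
  have hcl_sub : closure (Q i) ⊆ {y : EuclideanSpace ℝ (Fin 3) | ⟪c.1, y⟫ ≤ c.2} :=
    (closure_mono hQi_sub).trans (closure_lt_subset_le (continuous_const.inner continuous_id)
      continuous_const)
  -- an open ball around `x` inside `{f > t}`
  have hopen : IsOpen {y : EuclideanSpace ℝ (Fin 3) | t < f y} := isOpen_lt continuous_const hfc
  obtain ⟨ε, hε, hball⟩ := Metric.isOpen_iff.1 hopen x hxt
  -- the closed union of the other cells' closures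
  set W : Set (EuclideanSpace ℝ (Fin 3)) := ⋃ j ∈ Finset.univ.erase i, closure (Q j) with hW
  have hWc : IsClosed W := isClosed_biUnion_finset fun j _ => isClosed_closure
  -- the pushed points lie in `W`
  have hpush : ∀ s ∈ Set.Ioo (0 : ℝ) ε, x + s • c.1 ∈ W := by
    intro s hs
    have hmem : x + s • c.1 ∈ {y : EuclideanSpace ℝ (Fin 3) | t < f y} := by
      apply hball
      rw [Metric.mem_ball, dist_eq_norm, add_sub_cancel_left, norm_smul, h1, mul_one,
        Real.norm_eq_abs, abs_of_pos hs.1]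
      exact hs.2
    obtain ⟨j, hj⟩ := Set.mem_iUnion.1 (hcov hmem)
    have hji : j ≠ i := by
      rintro rfl
      have hle := hcl_sub hj
      simp only [mem_setOf_eq, inner_add_right, inner_smul_right, real_inner_self_eq_norm_sq, h1,
        one_pow, mul_one, hx1] at hle
      linarith [hs.1]
    exact Set.mem_biUnion (Finset.mem_erase.2 ⟨hji, Finset.mem_univ j⟩) hj
  -- hence the limit `x` lies in `W`
  have hxW : x ∈ W := by
    have htend : Tendsto (fun s : ℝ => x + s • c.1) (𝓝[>] (0 : ℝ)) (𝓝 x) := by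
      have h0 : Tendsto (fun s : ℝ => x + s • c.1) (𝓝 (0 : ℝ)) (𝓝 (x + (0 : ℝ) • c.1)) :=
        ((continuous_const.add (continuous_id.smul continuous_const)).tendsto 0)
      rw [zero_smul, add_zero] at h0
      exact h0.mono_left nhdsWithin_le_nhds
    rw [← hWc.closure_eq]
    refine mem_closure_of_tendsto htend ?_
    filter_upwards [Ioo_mem_nhdsGT hε] with s hs using hpush s hs
  obtain ⟨j, hj, hxj⟩ := Set.mem_iUnion₂.1 hxW
  refine ⟨j, (Finset.mem_erase.1 hj).1, ?_⟩
  rw [Set.inter_comm]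
  exact hopen.inter_closure ⟨hxt, hxj⟩

/-- **The super-level set agrees a.e. with the union of the pieces**: if `{f > t} ⊆ ⋃ closure Q_i`
for convex open cells `Q_i`, then `{f > t} =ᵐ ⋃ (Q_i ∩ {f > t})` (the difference lies in the null
frontiers). [cite: Maggi2012, Exercise 12.10 p. 123 — plumbing] -/
theorem superlevel_ae_eq_iUnion_pieces {k : ℕ} (Q : Fin k → Set (EuclideanSpace ℝ (Fin 3)))
    (hQc : ∀ i, Convex ℝ (Q i)) (hQo : ∀ i, IsOpen (Q i)) {f : EuclideanSpace ℝ (Fin 3) → ℝ}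
    {t : ℝ} (hcov : {x | t < f x} ⊆ ⋃ i, closure (Q i)) :
    ({x | t < f x} : Set (EuclideanSpace ℝ (Fin 3))) =ᵐ[volume] ⋃ i, (Q i ∩ {x | t < f x}) := by
  refine ae_eq_set.2 ⟨?_, ?_⟩
  · have hsub : {x | t < f x} \ (⋃ i, (Q i ∩ {x | t < f x})) ⊆ ⋃ i, frontier (Q i) := by
      rintro x ⟨hxt, hxn⟩
      obtain ⟨j, hj⟩ := Set.mem_iUnion.1 (hcov hxt)
      refine Set.mem_iUnion.2 ⟨j, ?_⟩
      rw [frontier, (hQo j).interior_eq]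
      exact ⟨hj, fun hxQ => hxn (Set.mem_iUnion.2 ⟨j, hxQ, hxt⟩)⟩
    refine measure_mono_null hsub ?_
    exact (measure_iUnion_null_iff).2 fun i => (hQc i).addHaar_frontier volume
  · have : (⋃ i, (Q i ∩ {x | t < f x})) \ {x | t < f x} = (∅ : Set (EuclideanSpace ℝ (Fin 3))) :=
      Set.sdiff_eq_empty.2 (Set.iUnion_subset fun i => Set.inter_subset_right)
    rw [this, measure_empty]

end Literature.Analysis.Convexity

end
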